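import Mathlib.MeasureTheory.Integral.IntervalIntegral.Basic
import Mathlib.Analysis.Calculus.FDeriv.Basic
import Literature.Analysis.FluidPDE.LatticeShearWords
import HarnessLib

/-!
# Lagrangian lattice carriers: Armstrong–Vicol's Lagrangian insertion for lattice shear words (notions)

Definitions only; an INTERFACE (existence is a separate route item). Companion of `LatticeShearWords.lean` (same namespace).

WHY. The fractal carrier typed in `FractalCarrierData.carrier` is the plain EULERIAN sum `∑' m, level (m+1)` of lattice shear
levels. Armstrong–Vicol do not sum Eulerian levels: level `m` is built in the LAGRANGIAN coordinates of the partial sum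
`b_{m−1}` — `b_m(t,x) = b_{m−1}(t,x) + Σ_l 𝟙_{[lτ″_m,(l+1)τ″_m)}(t) v_m(t, X⁻¹_{m−1}(t,x,lτ″_m))` with `∂_t X_{m−1}(·,x,s) = b_{m−1}(t, X_{m−1})`,
`X_{m−1}(s,x,s) = x`, the inverse flows REFRESHED on windows of length `τ″_m` (arXiv:2305.05048 §2.2, PDF p. 12; flows and the insertion
recursion `ψ_{m,k} ∘ X⁻¹_{m−1}(t,·,l_kτ″_m)`, PDF p. 18) — because a macroscopic drift destroys the enhancement of an Eulerian fine level
(their §6 = App. A, PDF pp. 68–69: «a mean drift of "generic" direction destroys the enhancement of diffusion when |v| ≫ 1»), and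
«when we homogenize the spatial oscillations (the shear flows), we need to work in Lagrangian coordinates» (PDF pp. 33–34: three fast scales,
the third being «the time scale τ″_m on which the Lagrangian flows X_{m−1} must refresh»). In Lagrangian coordinates of `b_{≤m−1}` the
transport operator is `∂_t`, so the CELL statements about one lattice word in a quiescent background (`SolenoidalWordDecay`,
`WordGainAtRate`, `IsotropicWordGain`) are exactly the cell input of the Lagrangian design (cell ad-ideate ROUND-15 §A–§C).

WHAT IS TYPED (definition item `defn-LagrangianLatticeCarrier`, planner ad-ideate-p1 g16, ROUND-15 §C.1; transposed to the flat 3-torus and to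
VECTOR levels, where AV's 2-D stream-function composition `∇^⊥(ψ ∘ X⁻¹) = X_*(∇^⊥ψ)` (area-preserving `X`) becomes the PUSHFORWARD / frozen-in
transport `(X_* v)(X y) = DX(y) v(y)`):
* `LagrangianLatticeCarrier k` — a structure EXTENDING `FractalCarrierData k` (design word, `N`, `a`, `kbar`, `nu0`, `K`, `gain`, positivity) by
  the DATA `refresh : ℕ → ℝ` (window length of level `m`; windows `[j·refresh m, (j+1)·refresh m)`, `j ∈ ℤ`, anchored at `0`), `θ : ℕ → ℝ`
  (strain budget of level `m`), `b : ℕ → ℝ → 𝕋³ → E` (the level fields; `b (m+1)` is level `m+1`, `b 0` is unused like `level 0`) and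
  `disp : ℕ → ℝ → ℝ → 𝕋³ → E` (the Lagrangian DISPLACEMENT of the flow of the partial sum `b 1 + … + b m` from time `s` to time `t`; an honest
  `E`-valued function on the torus, so that the flow `X m t s x = x + proj (disp m t s x)` has a derivative `id + D(lift (disp m t s))(repr x)` without
  lifting torus-valued maps), with positivity of `refresh`, `θ`;
* `X`, `flowDeriv`, `partialSum`, `strain` (derived); the Props `IsFlow m` (integral form of `∂_t X_m = b_{≤m}(t, X_m)`, `X_m(s,·,s) = id`),
  `IsInserted m` (on each window of level `m+1`, `b (m+1) t (X m t w y) = flowDeriv m t w y (level (m+1) t y)`: the Eulerian lattice level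
  `level (m+1)` of the underlying `FractalCarrierData` pushed forward by the coarse flow started at the window's left end `w`), `IsLagrangian`,
  the carrier `carrier E t x = ∑' m, E.b (m+1) t x`, `LPermissible` (= `Permissible` of the data ∧ `IsLagrangian` ∧ windows = whole numbers of fine
  periods ∧ nested windows ∧ the STRAIN clause `strain E m ≤ θ (m+1)`), and `Regular` / `RenormalisationBound` VERBATIM as in `FractalCarrierData`
  over the new carrier;
* the explicit slot flow `LatticePhase.shearMap` (why no ODE theory is needed downstream: inside one slot the velocity is `d′(t)·layer`, `m·x` is
  invariant along it, so the flow is the shear map `x ↦ x + proj((d/n)·layer(n·x))`, and a window's flow is a finite composition of such maps).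
Choices left to the items (per the request): decay / summability of `θ` and the super-geometric separation of the `N m` are NOT clauses of
`LPermissible` (items K1L / K3L of route `SolenoidalFractalHomogenisation` add them as hypotheses / deliver them); `IsInserted` resets the frame at
every window's left end (AV's sharp restart `𝟙_{[lτ″,(l+1)τ″)}`; their smooth cut-offs `ζ̂` are replaced here by the word's own ramps: windows are whole
numbers of fine periods, and the ramped word vanishes at period boundaries, so `t ↦ b (m+1) t` stays continuous across resets).
Provenance: the spec `run/shared/lean/pub/ad-ideate/ad-ideate-p1/ROUND-15.md` §C.1 / `r15/defn_informal.txt`; typed by a literature seat; definitions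
only — no statements, no named facts, no axioms, no instances.
[cite: ArmstrongVicol2025, §2.2 (PDF pp. 12, 18: Lagrangian flows X_m, insertion ψ_{m,k}∘X_{m−1}^{-1} on refresh windows τ″_m); §5 (PDF pp. 33–34); App. A = §6 (PDF pp. 68–69)]
-/

namespace Literature.Analysis.FluidPDE.LatticeShear

noncomputable section

open MeasureTheory Set Filter Topology
open scoped NNReal ENNReal
open Literature.Analysis Literature.Analysis.FunctionSpaces Literature.Analysis.FluidPDE

/-- The explicit flow of ONE slot of a lattice word at cell size `1/n` after accumulated (signed) slot time `d = ∫ envelope`: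
the shear map `x ↦ x + proj((d/n)·layer(n·x))` — inside a slot the velocity is `d′(t)·(1/n)·layer(n·x)` and `m·x` is invariant along
it, so the flow is this map (inverse = the map with `−d`). Optional helper of the interface (the flow of a word over a window is a finite
composition of such maps). [cite: MeshalkinSinai1961, pp. 1700–1705 (Kolmogorov shear layer)] -/
def LatticePhase.shearMap (P : LatticePhase) (n : ℕ) (d : ℝ) (x : UnitAddTorus (Fin 3)) : UnitAddTorus (Fin 3) :=
  x + Torus.proj ((d / (n : ℝ)) • P.layer (n • x))

/-- At accumulated time `0` the slot flow is the identity (`X(s,x,s) = x` for one slot). [cite: ArmstrongVicol2025, §2.2 (PDF p. 18: X_m(s,x,s) = x, b_0 = 0)] -/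
@[simp] theorem LatticePhase.shearMap_zero (P : LatticePhase) (n : ℕ) (x : UnitAddTorus (Fin 3)) :
    P.shearMap n 0 x = x := by
  simp only [LatticePhase.shearMap, zero_div, zero_smul]
  have h0 : Torus.proj (0 : EuclideanSpace ℝ (Fin 3)) = 0 := by
    funext i
    simp [Torus.proj]
  rw [h0, add_zero]

/-- **A LAGRANGIAN LATTICE CARRIER** (Armstrong–Vicol's Lagrangian insertion for lattice shear words, posited as an interface): the
bookkeeping data of a fractal carrier (`FractalCarrierData k`: one word design replayed at every level, cells `1/N m`, shear rates `a m`,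
renormalised viscosities `kbar m`, regime constants) PLUS the refresh-window lengths `refresh m`, the strain budgets `θ m`, the level
fields `b m : ℝ → 𝕋³ → E` and the Lagrangian displacements `disp m t s : 𝕋³ → E` of the flow of `b 1 + ⋯ + b m` from time `s` to time `t`.
Pure data + positivity; the constraints are `LPermissible` (incl. `IsLagrangian`: `disp` IS that flow and each level IS the pushed-forward
Eulerian lattice level on every window), the analysis is `Regular`, the output `RenormalisationBound`. Existence is the using route's crux.
[cite: ArmstrongVicol2025, §2.2 (PDF pp. 12, 18: b_m = b_{m−1} + Σ_l 𝟙_{[lτ″,(l+1)τ″)} v_m(t, X_{m−1}^{-1}(t,x,lτ″)); flows X_m)] -/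
structure LagrangianLatticeCarrier (k : ℕ) extends FractalCarrierData k where
  refresh : ℕ → ℝ
  θ : ℕ → ℝ
  b : ℕ → ℝ → UnitAddTorus (Fin 3) → EuclideanSpace ℝ (Fin 3)
  disp : ℕ → ℝ → ℝ → UnitAddTorus (Fin 3) → EuclideanSpace ℝ (Fin 3)
  refresh_pos : ∀ m, 0 < refresh m
  θ_pos : ∀ m, 0 < θ m

namespace LagrangianLatticeCarrier
variable {k : ℕ}

/-- The partial sum of the level fields `b 1 + ⋯ + b m` (the "coarse" field whose flow carries level `m+1`; `m = 0`: no field).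
[cite: ArmstrongVicol2025, §2.2 (PDF p. 12: b_{m−1} sweeps the level-m shears)] -/
def partialSum (E : LagrangianLatticeCarrier k) (m : ℕ) (t : ℝ) (x : UnitAddTorus (Fin 3)) : EuclideanSpace ℝ (Fin 3) :=
  ∑ i ∈ Finset.range m, E.b (i + 1) t x

/-- The Lagrangian FLOW MAP of the partial sum `b 1 + ⋯ + b m` from time `s` to time `t`, as a self-map of the torus:
`X m t s x = x + proj (disp m t s x)`. [cite: ArmstrongVicol2025, §2.2 (PDF p. 18: the flows X_m(t,·,s), X_m(s,x,s) = x)] -/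
def X (E : LagrangianLatticeCarrier k) (m : ℕ) (t s : ℝ) (x : UnitAddTorus (Fin 3)) : UnitAddTorus (Fin 3) :=
  x + Torus.proj (E.disp m t s x)

/-- The DERIVATIVE of the flow map `X m t s` at `x`, read on the displacement: `id + D(lift (disp m t s))(repr x)` (the lift
`disp ∘ proj : E → E` is lattice-periodic, so any representative gives the same value). [cite: ArmstrongVicol2025, §2.2 (PDF p. 18: ∇X_{m−1}, the distortion of the flows)] -/
def flowDeriv (E : LagrangianLatticeCarrier k) (m : ℕ) (t s : ℝ) (x : UnitAddTorus (Fin 3)) :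
    EuclideanSpace ℝ (Fin 3) →L[ℝ] EuclideanSpace ℝ (Fin 3) :=
  ContinuousLinearMap.id ℝ (EuclideanSpace ℝ (Fin 3)) + fderiv ℝ (Torus.lift (E.disp m t s)) (Torus.repr x)

/-- `IsFlow m`: the displacement `disp m` IS the flow of the partial sum `b 1 + ⋯ + b m`, in integral form (E-valued integrand, no
lifting of torus-valued maps): `disp m t s x = ∫_s^t (b 1 + ⋯ + b m)(r, X m r s x) dr` for all `t, s, x` — i.e. `∂_t X_m(·,x,s) = b_{≤m}(t, X_m)`,
`X_m(s,x,s) = x` (for `m = 0`: `disp 0 = 0`, `X 0 t s = id`). [cite: ArmstrongVicol2025, §2.2 (PDF p. 18: the flow ODE (e.flow.m.def))] -/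
def IsFlow (E : LagrangianLatticeCarrier k) (m : ℕ) : Prop :=
  ∀ t s : ℝ, ∀ x : UnitAddTorus (Fin 3),
    E.disp m t s x = ∫ r in s..t, E.partialSum m r (E.X m r s x)

/-- The `j`-th refresh WINDOW of level `m`: `[j·refresh m, (j+1)·refresh m)` (anchored at `0`). [cite: ArmstrongVicol2025, §2.2 (PDF p. 12: the windows [lτ″_m, (l+1)τ″_m))] -/
def window (E : LagrangianLatticeCarrier k) (m : ℕ) (j : ℤ) : Set ℝ :=
  Ico ((j : ℝ) * E.refresh m) (((j : ℝ) + 1) * E.refresh m)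

/-- `IsInserted m`: on every refresh window `[w, w + refresh (m+1))` of level `m+1` (`w = j·refresh (m+1)`), the level field `b (m+1)` IS the
Eulerian lattice level `level (m+1)` of the underlying data (shear rate `a (m+1)`, cells `1/N (m+1)`) PUSHED FORWARD by the coarse flow
`X m t w` started at the window's left end: `b (m+1) t (X m t w y) = D(X m t w)(y) · level (m+1) t y` — frozen-in transport, frame reset at
every window (AV insert the fine shears in the Lagrangian coordinates of `b_{m−1}`, restarting the inverse flow at each `lτ″_m`; in 2-D their
`∇^⊥(ψ ∘ X⁻¹)` is this pushforward since `X` preserves area). [cite: ArmstrongVicol2025, §2.2 (PDF pp. 12, 18: v_m(t, X_{m−1}^{-1}(t,x,lτ″_m)); ψ_{m,k}∘X_{m−1,l_k}^{-1})] -/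
def IsInserted (E : LagrangianLatticeCarrier k) (m : ℕ) : Prop :=
  ∀ j : ℤ, ∀ t ∈ E.window (m + 1) j, ∀ y : UnitAddTorus (Fin 3),
    E.b (m + 1) t (E.X m t ((j : ℝ) * E.refresh (m + 1)) y) =
      E.flowDeriv m t ((j : ℝ) * E.refresh (m + 1)) y (E.toFractalCarrierData.level (m + 1) t y)

/-- `IsLagrangian`: every `disp m` is the flow of `b 1 + ⋯ + b m` and every level `b (m+1)` is inserted in the Lagrangian coordinates of that
flow (so, inductively from `disp 0 = 0`: `b 1 = level 1`, `b 2 = (X 1)_* level 2` window by window, …). [cite: ArmstrongVicol2025, §2.2 (PDF p. 18: the iterative construction)] -/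
def IsLagrangian (E : LagrangianLatticeCarrier k) : Prop :=
  ∀ m, E.IsFlow m ∧ E.IsInserted m

/-- The CARRIER: the sum of the level fields `b (m+1)`, `m ≥ 0` (pointwise `tsum`; summability is part of `Regular`) — Armstrong–Vicol's
`b = lim b_m`. [cite: ArmstrongVicol2025, §2.2 (PDF p. 18: b as the limit m → ∞)] -/
def carrier (E : LagrangianLatticeCarrier k) (t : ℝ) (x : UnitAddTorus (Fin 3)) : EuclideanSpace ℝ (Fin 3) :=
  ∑' m : ℕ, E.b (m + 1) t x

/-- The STRAIN of the coarse levels `1, …, m` accumulated over one refresh window of level `m+1`: `(a 1 + ⋯ + a m) · refresh (m+1)` (the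
Lipschitz constant of `b_{≤m}` is of order `Σ a i`; AV: «the inverse flows must be renewed on a time scale which is much less than the inverse
of the Lipschitz constant of b_{m−1}»). [cite: ArmstrongVicol2025, §2.2 (PDF p. 12)] -/
def strain (E : LagrangianLatticeCarrier k) (m : ℕ) : ℝ :=
  (∑ i ∈ Finset.range m, E.a (i + 1)) * E.refresh (m + 1)

/-- **L-PERMISSIBILITY** — the parameter constraints of the Lagrangian cascade: the `FractalCarrierData` clauses (`Permissible`: nested
lattices, Taylor recursion, quasi-static regime, Bloch threshold, viscous domination, commensurable periods, `kbar → 0`) ∧ `IsLagrangian` ∧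
(W1) every refresh window of level `m+1` is a WHOLE NUMBER of physical periods of the level-`(m+1)` word (so windows start and end at slot
boundaries, where the ramped velocity vanishes — frame resets keep `t ↦ b (m+1) t` continuous) ∧ (W2) the windows of level `m+1` NEST in
those of level `m` ∧ (S) STRAIN: `strain E m ≤ θ (m+1)` for every `m` ∧ (A) AMPLITUDE DECAY: `a (m+1) ≤ N (m+1) ^ (1 − α₀)` for some
`α₀ > 0` and every `m` — the level velocity amplitudes `a (m+1) / N (m+1) ≤ N (m+1) ^ (−α₀)` are summable (Armstrong–Vicol: shear rates
`a_m := ε_m^{β−2}`, stream amplitudes `|ψ_{m,k}| ≤ a_m ε_m² = ε_m^β` «which is summable over m», giving the `L^∞` convergence of the series: it is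
what makes the level series converge NORMALLY, so that the infinite tail `carrier − partialSum j` has the weak stream-potential identity and
sup bounds that the tail / one-level steps of the renormalisation consume). Decay / summability of `θ` and super-geometric separation of the `N m`
are left to the using items. Amended 2026-08-28 (cell `ad-ideate`, planner ruling R23-1 on finding F-g23-1: the clause is delivered by the
bookkeeping of the construction item K3L (`a (m+1) ≤ N (m+1) ^ (1 − 1/16)`) and consumed by the tail step of K1L, but was carried by neither
`LPermissible` nor `Regular`; appended LAST so that every existing projection / accessor of the first five conjuncts is unchanged).
[cite: ArmstrongVicol2025, §2.2 (PDF p. 12: the two new constraints on τ″_m; PDF p. 16: a_m := ε_m^{β−2}; PDF p. 18: |ψ_{m,k}| ≤ a_m ε_m² = ε_m^β summable, L^∞ convergence of (e.def.b)) and §5 (PDF pp. 33–34)] -/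
def LPermissible (E : LagrangianLatticeCarrier k) : Prop :=
  E.toFractalCarrierData.Permissible ∧ E.IsLagrangian ∧
  (∀ m, ∃ r : ℕ, 0 < r ∧ E.refresh (m + 1) = (r : ℝ) * E.toFractalCarrierData.physPeriod (m + 1)) ∧
  (∀ m, ∃ q : ℕ, 0 < q ∧ E.refresh m = (q : ℝ) * E.refresh (m + 1)) ∧
  (∀ m, E.strain m ≤ E.θ (m + 1)) ∧
  (∃ α₀ : ℝ, 0 < α₀ ∧ ∀ m, E.a (m + 1) ≤ ((E.N (m + 1) : ℝ)) ^ (1 - α₀))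

/-- LEVEL REGULARITY — the per-level / per-flow regularity package of a Lagrangian carrier (all clauses QUALITATIVE, no constants):
(R0) the level series converges pointwise; (L1) every level field `b (m+1)` is jointly continuous in `(t, x)`; (L2) weakly divergence free at
every time; (L3) smooth in `x` at every time (`Torus.IsSmooth`, i.e. `C^∞` of the lift — NOT analytic), every `x`-derivative bounded uniformly in `t`; (L4) time-periodic; (F1) every displacement
`disp m · s ·` is jointly continuous, smooth in `x`, with `x`-derivatives bounded on every refresh window of level `m+1` (flows started at the
window's left end); (F2) the flow maps satisfy `X m s s = id`, the two-parameter group law, and preserve the volume of the torus. This is what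
Armstrong–Vicol's construction has by fiat (the `b_m` are smooth, the `X_m` are volume-preserving flows of smooth divergence-free fields, renewed
on the windows `[lτ″_m, (l+1)τ″_m)`), and what the analysis of the cascade consumes (weak existence / energy identity / uniqueness along the partial
sums `b 1 + ⋯ + b m`, Lagrangian coordinates); the QUANTITATIVE distortion bounds (their §5.1) are the using route's analysis, not clauses here.
Added 2026-08-28 (cell `ad-ideate`, planner ruling R22-1 on finding F-g5-1: `LPermissible` pins the levels only through the flow / insertion
equations, from which these facts would cost an abstract ODE-flow package on the analysis side, while the explicit construction has them for free).
[cite: ArmstrongVicol2025, §2.2 (PDF p. 18: the b_m are smooth; X_m the flows of b_{≤m}, renewed on refresh windows) and §5.1 (flow estimates)] -/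
def LevelRegular (E : LagrangianLatticeCarrier k) : Prop :=
  (∀ t x, Summable fun m => E.b (m + 1) t x) ∧
  (∀ m, Continuous (Function.uncurry (E.b (m + 1)))) ∧
  (∀ m t, Torus.IsWeaklyDivFree (E.b (m + 1) t)) ∧
  (∀ m t, Torus.IsSmooth (E.b (m + 1) t)) ∧
  (∀ m (n : ℕ), ∃ C : ℝ, ∀ t y, ‖iteratedFDeriv ℝ n (Torus.lift (E.b (m + 1) t)) y‖ ≤ C) ∧
  (∀ m, ∃ τ : ℝ, 0 < τ ∧ Function.Periodic (E.b (m + 1)) τ) ∧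
  (∀ m s, Continuous fun p : ℝ × UnitAddTorus (Fin 3) => E.disp m p.1 s p.2) ∧
  (∀ m t s, Torus.IsSmooth (E.disp m t s)) ∧
  (∀ m (n : ℕ) (j : ℤ), ∃ C : ℝ, ∀ t ∈ E.window (m + 1) j, ∀ y,
      ‖iteratedFDeriv ℝ n (Torus.lift (E.disp m t ((j : ℝ) * E.refresh (m + 1)))) y‖ ≤ C) ∧
  (∀ m s, E.X m s s = id) ∧
  (∀ m t s r, E.X m t s ∘ E.X m s r = E.X m t r) ∧
  (∀ m t s, MeasurePreserving (E.X m t s) volume volume)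

/-- REGULARITY of the summed Lagrangian carrier — `FractalCarrierData.Regular` over the new carrier, with the bare pointwise-summability conjunct
replaced by the per-level package `LevelRegular` (whose clause (R0) is that summability): the level series converges pointwise AND every level /
flow is regular in the sense of `LevelRegular`, the sum is `C_t C^{0,α}_x` for some `α > 0`, time-periodic, and weakly divergence free at every time.
Amended 2026-08-28 (planner ruling R22-1 on F-g5-1): the per-level / per-flow regularity package `LevelRegular` — AV §2.2 (PDF p. 18: `b_m` smooth,
`X_m` volume-preserving flows), §5.1 (flow estimates) — is part of the regularity of a Lagrangian carrier; qualitative clauses only, quantitative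
distortion bounds are the using route's analysis. (The only consumer at amendment time, `leaf_of_lagrangianLatticeCarrier`, discards the first
conjunct; route statements are textually unchanged and only become stronger hypotheses / conclusions.)
[cite: ArmstrongVicol2025, Thm. 1.1 (regularity class of the carrier) and §2.2 (PDF p. 18)] -/
def Regular (E : LagrangianLatticeCarrier k) : Prop :=
  E.LevelRegular ∧
  ∃ α : ℝ≥0, 0 < α ∧ FunctionSpaces.ContinuousInHolderOn univ α E.carrier ∧
    (∃ τ : ℝ, 0 < τ ∧ Function.Periodic E.carrier τ) ∧ ∀ t, Torus.IsWeaklyDivFree (E.carrier t)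

/-- The OUTPUT of the renormalisation along the tuned viscosities `ν_j = kbar j` — VERBATIM `FractalCarrierData.RenormalisationBound` over the
new carrier: for every length-scale class `R`, a fixed fraction `η(R) > 0` of the energy of every `H¹` divergence-free mean-zero datum of that
class is gone by time `1/2`, uniformly in `j ≥ j₀(R)` and in the weak solution.
[cite: ArmstrongVicol2025, Thm. 1.1 (shape of the conclusion, transposed to the passive solenoidal vector)] -/
def RenormalisationBound (E : LagrangianLatticeCarrier k) : Prop :=
  ∀ R : ℝ≥0, ∃ η > (0:ℝ), ∃ j₀ : ℕ, ∀ j ≥ j₀, ∀ w₀ : UnitAddTorus (Fin 3) → EuclideanSpace ℝ (Fin 3),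
    FunctionSpaces.Torus.MemSobolev 1 (FunctionSpaces.EuclideanSpace.complexify ∘ w₀) →
    Torus.HasZeroMean w₀ → Torus.IsWeaklyDivFree w₀ →
    Torus.eGradNormSq w₀ ≤ (R : ℝ≥0∞) * ENNReal.ofReal (Torus.vectorL2Sq w₀) →
    ∀ w, Torus.IsWeakPassiveVectorOn 0 1 (E.kbar j) E.carrier w₀ w →
      ∀ᵐ t ∂(volume.restrict (Ioo (1/2 : ℝ) 1)), ∫ x, ‖w t x‖ ^ 2 ≤ (1 - η) * ∫ x, ‖w₀ x‖ ^ 2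

/-! ### Unfolding lemmas (API) -/

/-- The flow map unfolded: `X m t s x = x + proj (disp m t s x)`. [cite: ArmstrongVicol2025, §2.2 (PDF p. 18: the flows X_m(t,·,s))] -/
theorem X_apply (E : LagrangianLatticeCarrier k) (m : ℕ) (t s : ℝ) (x : UnitAddTorus (Fin 3)) :
    E.X m t s x = x + Torus.proj (E.disp m t s x) := rfl

/-- The carrier unfolded: `b = Σ_{m ≥ 1} b_m`. [cite: ArmstrongVicol2025, §2.2 (PDF p. 18: b as the limit of the b_m)] -/
theorem carrier_apply (E : LagrangianLatticeCarrier k) (t : ℝ) (x : UnitAddTorus (Fin 3)) :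
    E.carrier t x = ∑' m : ℕ, E.b (m + 1) t x := rfl

/-- No coarse field below level `1`: `partialSum 0 = 0` (AV's initialisation `b_0 := 0`). [cite: ArmstrongVicol2025, §2.2 (PDF p. 18: X_m(s,x,s) = x, b_0 = 0)] -/
@[simp] theorem partialSum_zero (E : LagrangianLatticeCarrier k) (t : ℝ) (x : UnitAddTorus (Fin 3)) :
    E.partialSum 0 t x = 0 := by
  simp [partialSum]

/-- No strain below level `1`: `strain 0 = 0` (nothing advects level `1`). [cite: ArmstrongVicol2025, §2.2 (PDF p. 12: the constraints on the refresh windows τ″_m)] -/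
@[simp] theorem strain_zero (E : LagrangianLatticeCarrier k) : E.strain 0 = 0 := by
  simp [strain]

/-- `IsFlow 0` forces the level-`0` displacement to vanish (the flow of `b_0 = 0` is the identity). [cite: ArmstrongVicol2025, §2.2 (PDF p. 18: X_m(s,x,s) = x, b_0 = 0)] -/
theorem disp_zero_of_isFlow (E : LagrangianLatticeCarrier k) (h : E.IsFlow 0) (t s : ℝ) (x : UnitAddTorus (Fin 3)) :
    E.disp 0 t s x = 0 := by
  have := h t s x
  simpa [partialSum] using this

/-- … hence `X 0 t s = id` (level `1` is inserted Eulerian: `b_1 = v_1`). [cite: ArmstrongVicol2025, §2.2 (PDF p. 18: X_m(s,x,s) = x, b_0 = 0)] -/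
theorem X_zero_of_isFlow (E : LagrangianLatticeCarrier k) (h : E.IsFlow 0) (t s : ℝ) (x : UnitAddTorus (Fin 3)) :
    E.X 0 t s x = x := by
  rw [X_apply, E.disp_zero_of_isFlow h]
  have h0 : Torus.proj (0 : EuclideanSpace ℝ (Fin 3)) = 0 := by
    funext i
    simp [Torus.proj]
  rw [h0, add_zero]

/-- `LPermissible` implies the `FractalCarrierData` permissibility of the underlying bookkeeping data. [cite: ArmstrongVicol2025, §3 (3.42)–(3.43) (parameter bookkeeping, transposed)] -/
theorem LPermissible.permissible {E : LagrangianLatticeCarrier k} (h : E.LPermissible) :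
    E.toFractalCarrierData.Permissible := h.1

/-- `LPermissible` implies `IsLagrangian`. [cite: ArmstrongVicol2025, §2.2 (PDF p. 18: the iterative Lagrangian construction)] -/
theorem LPermissible.isLagrangian {E : LagrangianLatticeCarrier k} (h : E.LPermissible) : E.IsLagrangian := h.2.1

/-- `LPermissible` implies the strain clause. [cite: ArmstrongVicol2025, §2.2 (PDF p. 12: the constraints on the refresh windows τ″_m)] -/
theorem LPermissible.strain_le {E : LagrangianLatticeCarrier k} (h : E.LPermissible) (m : ℕ) :
    E.strain m ≤ E.θ (m + 1) := h.2.2.2.2.1 m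

/-- `LPermissible` implies the amplitude-decay clause (A): `a (m+1) ≤ N (m+1) ^ (1 − α₀)` for some `α₀ > 0` (amendment 2, 2026-08-28).
[cite: ArmstrongVicol2025, §2.2 (PDF p. 16: a_m := ε_m^{β−2}; PDF p. 18: |ψ_{m,k}| ≤ a_m ε_m² = ε_m^β, summable over m)] -/
theorem LPermissible.amplitude_decay {E : LagrangianLatticeCarrier k} (h : E.LPermissible) :
    ∃ α₀ : ℝ, 0 < α₀ ∧ ∀ m, E.a (m + 1) ≤ ((E.N (m + 1) : ℝ)) ^ (1 - α₀) := h.2.2.2.2.2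

/-- `LPermissible` implies the refresh-window clause (W1): every refresh window of level `m+1` is a whole number of physical periods.
[cite: ArmstrongVicol2025, §2.2 (PDF p. 12: the constraints on the refresh windows τ″_m)] -/
theorem LPermissible.refresh_periods {E : LagrangianLatticeCarrier k} (h : E.LPermissible) (m : ℕ) :
    ∃ r : ℕ, 0 < r ∧ E.refresh (m + 1) = (r : ℝ) * E.toFractalCarrierData.physPeriod (m + 1) := h.2.2.1 m

/-- `LPermissible` implies the nesting clause (W2): the windows of level `m+1` nest in those of level `m`.
[cite: ArmstrongVicol2025, §2.2 (PDF p. 12: the constraints on the refresh windows τ″_m)] -/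
theorem LPermissible.refresh_nested {E : LagrangianLatticeCarrier k} (h : E.LPermissible) (m : ℕ) :
    ∃ q : ℕ, 0 < q ∧ E.refresh m = (q : ℝ) * E.refresh (m + 1) := h.2.2.2.1 m

/-- Constructor of `LPermissible` from its six clauses (so that producers do not depend on the nesting of the conjunction).
[cite: ArmstrongVicol2025, §2.2 (PDF pp. 12, 16, 18)] -/
theorem LPermissible.intro {E : LagrangianLatticeCarrier k} (hP : E.toFractalCarrierData.Permissible) (hL : E.IsLagrangian)
    (hW1 : ∀ m, ∃ r : ℕ, 0 < r ∧ E.refresh (m + 1) = (r : ℝ) * E.toFractalCarrierData.physPeriod (m + 1))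
    (hW2 : ∀ m, ∃ q : ℕ, 0 < q ∧ E.refresh m = (q : ℝ) * E.refresh (m + 1))
    (hS : ∀ m, E.strain m ≤ E.θ (m + 1))
    (hA : ∃ α₀ : ℝ, 0 < α₀ ∧ ∀ m, E.a (m + 1) ≤ ((E.N (m + 1) : ℝ)) ^ (1 - α₀)) : E.LPermissible :=
  ⟨hP, hL, hW1, hW2, hS, hA⟩

/-! ### Accessors of the regularity package (so that consumers do not depend on the order of the conjuncts) -/

/-- `Regular` implies the per-level package `LevelRegular`. [cite: ArmstrongVicol2025, §2.2 (PDF p. 18: the b_m are smooth, X_m flows)] -/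
theorem Regular.levelRegular {E : LagrangianLatticeCarrier k} (h : E.Regular) : E.LevelRegular := h.1

/-- `Regular`: the summed carrier is `C_t C^{0,α}_x` for some `α > 0`, time-periodic and weakly divergence free at every time (the conjuncts after
`LevelRegular`, unchanged by the 2026-08-28 amendment). [cite: ArmstrongVicol2025, Thm. 1.1 (regularity class of the carrier)] -/
theorem Regular.carrier_regular {E : LagrangianLatticeCarrier k} (h : E.Regular) :
    ∃ α : ℝ≥0, 0 < α ∧ FunctionSpaces.ContinuousInHolderOn univ α E.carrier ∧
      (∃ τ : ℝ, 0 < τ ∧ Function.Periodic E.carrier τ) ∧ ∀ t, Torus.IsWeaklyDivFree (E.carrier t) := h.2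

/-- (R0) The level series converges pointwise. [cite: ArmstrongVicol2025, §2.2 (PDF p. 18: b as the limit of the b_m)] -/
theorem LevelRegular.summable {E : LagrangianLatticeCarrier k} (h : E.LevelRegular) (t : ℝ) (x : UnitAddTorus (Fin 3)) :
    Summable fun m => E.b (m + 1) t x := h.1 t x

/-- (L1) Every level field is jointly continuous in `(t, x)`. [cite: ArmstrongVicol2025, §2.2 (PDF p. 18: the b_m are smooth)] -/
theorem LevelRegular.continuous_uncurry_b {E : LagrangianLatticeCarrier k} (h : E.LevelRegular) (m : ℕ) :
    Continuous (Function.uncurry (E.b (m + 1))) := h.2.1 m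

/-- (L2) Every level field is weakly divergence free at every time. [cite: ArmstrongVicol2025, §2.2 (PDF p. 18: divergence-free levels)] -/
theorem LevelRegular.isWeaklyDivFree_b {E : LagrangianLatticeCarrier k} (h : E.LevelRegular) (m : ℕ) (t : ℝ) :
    Torus.IsWeaklyDivFree (E.b (m + 1) t) := h.2.2.1 m t

/-- (L3a) Every level field is smooth in `x` at every time. [cite: ArmstrongVicol2025, §2.2 (PDF p. 18: the b_m are smooth)] -/
theorem LevelRegular.isSmooth_b {E : LagrangianLatticeCarrier k} (h : E.LevelRegular) (m : ℕ) (t : ℝ) :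
    Torus.IsSmooth (E.b (m + 1) t) := h.2.2.2.1 m t

/-- (L3b) Every `x`-derivative of a level field is bounded uniformly in `t`. [cite: ArmstrongVicol2025, §2.2 (PDF p. 18: the b_m are smooth)] -/
theorem LevelRegular.exists_norm_iteratedFDeriv_b_le {E : LagrangianLatticeCarrier k} (h : E.LevelRegular) (m n : ℕ) :
    ∃ C : ℝ, ∀ t y, ‖iteratedFDeriv ℝ n (Torus.lift (E.b (m + 1) t)) y‖ ≤ C := h.2.2.2.2.1 m n

/-- (L4) Every level field is time-periodic. [cite: ArmstrongVicol2025, §2.2 (PDF p. 18: time-periodic levels)] -/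
theorem LevelRegular.exists_periodic_b {E : LagrangianLatticeCarrier k} (h : E.LevelRegular) (m : ℕ) :
    ∃ τ : ℝ, 0 < τ ∧ Function.Periodic (E.b (m + 1)) τ := h.2.2.2.2.2.1 m

/-- (F1a) Every displacement `(t, x) ↦ disp m t s x` is jointly continuous. [cite: ArmstrongVicol2025, §2.2 (PDF p. 18: the flows X_m)] -/
theorem LevelRegular.continuous_disp {E : LagrangianLatticeCarrier k} (h : E.LevelRegular) (m : ℕ) (s : ℝ) :
    Continuous fun p : ℝ × UnitAddTorus (Fin 3) => E.disp m p.1 s p.2 := h.2.2.2.2.2.2.1 m s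

/-- (F1b) Every displacement `disp m t s` is smooth in `x`. [cite: ArmstrongVicol2025, §2.2 (PDF p. 18: the flows X_m)] -/
theorem LevelRegular.isSmooth_disp {E : LagrangianLatticeCarrier k} (h : E.LevelRegular) (m : ℕ) (t s : ℝ) :
    Torus.IsSmooth (E.disp m t s) := h.2.2.2.2.2.2.2.1 m t s

/-- (F1c) On every refresh window of level `m+1`, the `x`-derivatives of the displacement of the coarse flow started at the window's left end
are bounded. [cite: ArmstrongVicol2025, §5.1 (flow estimates on the refresh windows)] -/
theorem LevelRegular.exists_norm_iteratedFDeriv_disp_le {E : LagrangianLatticeCarrier k} (h : E.LevelRegular) (m n : ℕ) (j : ℤ) :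
    ∃ C : ℝ, ∀ t ∈ E.window (m + 1) j, ∀ y,
      ‖iteratedFDeriv ℝ n (Torus.lift (E.disp m t ((j : ℝ) * E.refresh (m + 1)))) y‖ ≤ C := h.2.2.2.2.2.2.2.2.1 m n j

/-- (F2a) `X m s s = id`. [cite: ArmstrongVicol2025, §2.2 (PDF p. 18: X_m(s,x,s) = x)] -/
theorem LevelRegular.X_self {E : LagrangianLatticeCarrier k} (h : E.LevelRegular) (m : ℕ) (s : ℝ) : E.X m s s = id :=
  h.2.2.2.2.2.2.2.2.2.1 m s

/-- (F2b) The two-parameter group law of the flow maps: `X m t s ∘ X m s r = X m t r`. [cite: ArmstrongVicol2025, §2.2 (PDF p. 18: the flows X_m)] -/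
theorem LevelRegular.X_comp_X {E : LagrangianLatticeCarrier k} (h : E.LevelRegular) (m : ℕ) (t s r : ℝ) :
    E.X m t s ∘ E.X m s r = E.X m t r := h.2.2.2.2.2.2.2.2.2.2.1 m t s r

/-- (F2c) The flow maps preserve the volume of the torus (flows of divergence-free fields). [cite: ArmstrongVicol2025, §2.2 (PDF p. 18: area-preserving flows X_m)] -/
theorem LevelRegular.measurePreserving_X {E : LagrangianLatticeCarrier k} (h : E.LevelRegular) (m : ℕ) (t s : ℝ) :
    MeasurePreserving (E.X m t s) volume volume := h.2.2.2.2.2.2.2.2.2.2.2 m t s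

end LagrangianLatticeCarrier

end

end Literature.Analysis.FluidPDE.LatticeShear
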